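import Mathlib.Algebra.Module.Torsion.Basic
import Mathlib.Data.ENat.Lattice
import Mathlib.LinearAlgebra.TensorProduct.Associator
import Mathlib.NumberTheory.Padics.PadicIntegers
import Literature.NumberTheory.GaloisRepresentations.ContinuousH1
import Literature.NumberTheory.GaloisRepresentations.ContinuousCohomologyConnecting
import Literature.NumberTheory.GaloisRepresentations.EulerSystem
import Literature.NumberTheory.GaloisRepresentations.PAdicHodge
import HarnessLib

/-!
# The Bloch–Kato finite part `H¹_f(K_v, T)` of a lattice (compact side), the singular
# quotient `H¹_s(K_v, T)`, the map `loc_v^s`, and Rubin's index of divisibility `ind_O`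

Let `K` be a finite extension of `ℚ_p`, `V` a finite-dimensional `ℚ_p`-vector space with a
continuous `Γ_K`-action and `T ⊆ V` a `Γ_K`-stable `ℤ_p`-lattice (more generally an
`O`-lattice, `O` the integers of a finite extension of `ℚ_p`).  Bloch and Kato define the
**finite part** at `p`
`H¹_f(K, V) = ker (H¹(K, V) → H¹(K, B_crys ⊗_{ℚ_p} V))` [BlochKato1990, (3.7.2)] and, for the
lattice, `H¹_f(K, T) = ι⁻¹ H¹_f(K, V)` with `ι : H¹(K, T) → H¹(K, V) = H¹(K, T ⊗ ℚ)`
[BlochKato1990, (3.7.3)]; all cohomology is continuous-cochain cohomology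
[BlochKato1990, Remark 1.18].  Rubin's Euler-system machine uses exactly these groups
[Rubin1998Durham, §1: "`H¹_𝒮(ℚ_{n,v}, T)` is the inverse image of `H¹_𝒮(ℚ_{n,v}, V)`";
Rubin2000, §1.3], the **singular quotient** `H¹_s(K_v, T) = H¹(K_v, T) / H¹_f(K_v, T)`
(Rubin 1998: `H¹_{/𝒮}`), the composite **`loc_v^s : H¹(K, T) → H¹(K_v, T) → H¹_s(K_v, T)`**
(Rubin 1998, §3: `loc_p^{ram}`) for a number field `K` and a place `v ∣ p`
[Rubin1998Durham, §3], and, to measure the bottom class of an Euler system, the **index of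
divisibility** `ind_O(y) = sup {m : y ∈ 𝔪^m M + M_tors} ≤ ∞` of an element `y` of an `O`-module
`M` — "the largest power of the maximal ideal by which `c` can be divided in `H¹(ℚ, T)/torsion`"
[Rubin2000, §2.2 (Thm. 2.2.2); restated verbatim in Lei–Loeffler–Zerbes, *Euler systems for
Rankin–Selberg convolutions*, Ann. of Math. 180 (2014), Thm. 7.1.5].

## The observation that makes the definition possible here

The tree's period rings are abstract data without topology (`CrystallinePeriodRingData`, file
`PAdicHodge`: an `F₀`-algebra `B` with a `Γ_F`-action by ring automorphisms and a Frobenius), so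
the group `H¹(K, B_crys ⊗ V)` itself cannot be formed as continuous cohomology.  **It is not
needed:** a class `x = [c] ∈ H¹(K, V)` maps to zero in `H¹(K, B ⊗ V)` (continuous cochains,
[BlochKato1990, Rem. 1.18]) iff the cocycle `σ ↦ 1 ⊗ c(σ)` is a *coboundary* there, i.e. iff

  `∃ b ∈ B ⊗ V, ∀ σ, 1 ⊗ c(σ) = σ·b - b`   (`σ` acting diagonally on `B ⊗ V`),

a condition which involves no topology on `B` (degree-`1` coboundaries are the maps
`σ ↦ σ b - b`, automatically continuous).  Moreover `B ⊗_{ℚ_p} V = B ⊗_{ℚ_p} (ℚ_p ⊗_{ℤ_p} T)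
= B ⊗_{ℤ_p} T` and the composite `T → V → B ⊗ V` is `t ↦ 1 ⊗ t`, so that Bloch–Kato's
`ι⁻¹ H¹_f(K, V)` is, *verbatim*, the set of classes `[c] ∈ H¹(K, T)` with
`∃ b ∈ T ⊗_{ℤ_p} B, ∀ σ, c(σ) ⊗ 1 = σ·b - b`.  This file takes that as the definition
(`ContinuousRep.periodKernel`, for any "period ring" `B`; `GaloisRep.blochKatoFiniteSubmodule`
for `B = 𝔅.B`, `𝔅` a crystalline period-ring datum), directly on the lattice and without
constructing the topological vector space `V = T[1/p]`.  Applied to a `ℚ_p`-representation `V`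
itself (`A` a `ℚ_p`-algebra, `V ⊗_{ℤ_p} B = V ⊗_{ℚ_p} B`) the same definition is Bloch–Kato's
`H¹_f(K, V)`; applied with `B_dR` it is `H¹_g` (`periodKernel_mono`: `B ⊆ B'` gives
`H¹_f ⊆ H¹_g`).

## Main definitions

* `ContinuousRep.periodRep R B τ` — the diagonal representation of `G` on `M ⊗[R] B` for a
  continuous representation `τ` of `G` on `M` and a commutative `R`-algebra `B` with a `G`-action
  by `R`-algebra automorphisms; `ContinuousRep.periodCocycles`, **`ContinuousRep.periodKernel
  R B τ ⊆ H¹_cont(G, M)`** = `ker (H¹(G, M) → H¹(G, M ⊗_R B))`, the classes of continuous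
  crossed homomorphisms that become coboundaries in `M ⊗_R B` (an `A`-submodule of Mathlib's
  `continuousCohomology 1 τ.toTopRep`, via the tree's `oneCocycleClassₗ`).
* `GaloisRep.blochKatoFiniteSubmodule p 𝔅 τ = H¹_f(F, T)` for `τ : GaloisRep F A M` over a field
  `F ⊇ ℚ_p` (intended: a finite extension of `ℚ_p`), `A` a `ℤ_p`-algebra (intended `O`), `M` an
  `A`-module and `ℤ_p`-module compatibly (intended: an `O`-lattice `T`, e.g. `Fin n → O` of a
  `FramedGaloisRep`), relative to a crystalline period-ring datum
  `𝔅 : CrystallinePeriodRingData ℚ_[p] F` (intended: `B_crys`): `periodKernel ℤ_[p] 𝔅.B`.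
* Over a number field `K`, for `T : GaloisRep K A M`, a finite place `v` (intended `v ∣ p`) and
  `𝔅 : CrystallineDatumAt p v` (a `ℚ_p`-algebra structure on `K_v = v.adicCompletion K`, e.g. the
  tree's `LocalField.adicCompletionPadicAlgebra v p hv`, together with a crystalline period-ring
  datum for `K_v`; the `Σ'`-shape of `GaloisRep.IsGeometric`):
  **`GaloisRep.blochKatoFiniteSubgroupCompact p T v 𝔅 = H¹_f(K_v, T) ⊆ H¹(K_v, T)`**
  (`H¹(K_v, T) = continuousCohomology 1 (T.toLocal v).toTopRep`, the target of the tree's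
  localisation `GaloisRep.localizeH T v 1`), the **singular quotient**
  `GaloisRep.blochKatoSingularQuotient p T v 𝔅 = H¹_s(K_v, T) = H¹(K_v, T) ⧸ H¹_f(K_v, T)`, and
  **`GaloisRep.locSingular p T v 𝔅 = loc_v^s : H¹(K, T) →ₗ[A] H¹_s(K_v, T)`**;
  `locSingular_eq_zero_iff : loc_v^s c = 0 ↔ loc_v c ∈ H¹_f(K_v, T)` ("`c` is crystalline at
  `v`").
* `indexOfDivisibility A y : ℕ∞ = ind_A(y) = sup {m : y ∈ 𝔪_A^m N + N_tors}` for a local ring `A`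
  and `y` in an `A`-module `N`.

## API

* `oneCocycleClass_mem_periodKernel_iff` (the condition does not depend on the cocycle chosen),
  `mem_periodKernel_of_smul_eq_zero` / `mem_blochKatoFiniteSubmodule_of_smul_eq_zero` (**the
  `ℤ_p`-torsion of `H¹(K, T)` lies in `H¹_f(K, T)`**, [BlochKato1990, after (3.7.3)]: "Thus
  `H¹_f(K, T)` always contains the torsion subgroup of `H¹(K, T)`"), `periodKernel_mono`
  (functoriality in `B`), `map_periodKernel_le` (naturality in `M`) and
  **`periodKernel_eq_comap`**: if `f ⊗ B : M ⊗_R B → M' ⊗_R B` is bijective (as for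
  `T ↪ V = T[1/p]`, `B` a `ℚ_p`-algebra) the period kernel of `M` is the preimage under `H¹(f)`
  of that of `M'` — the (3.7.3) recipe `H¹_f(K, T) = ι⁻¹ H¹_f(K, V)` as a theorem, for whenever
  `V` is available as a representation; `periodKernel_eq_bot_of_smul_eq` (trivial action on `B` ⇒
  no kernel), `locSingular_eq_zero_iff`, `ker_locSingular`, `le_indexOfDivisibility`,
  `indexOfDivisibility_le_iff`, `indexOfDivisibility_eq_top_of_mem_torsion`.

## Design notes

* **Why not through `V`.**  See above: `ι⁻¹ ker (H¹(K, V) → H¹(K, B ⊗ V))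
  = ker (H¹(K, T) → H¹(K, B ⊗_{ℤ_p} T))` on the nose, and the right-hand side needs neither a
  topology on `B` nor the topological module `V = T ⊗ ℚ_p` (absent from the tree for a general
  `GaloisRep K O M`).  The companion file `BlochKatoSelmerGroup` (discrete side `W = V/T`) takes
  the condition at `v ∣ p` as a parameter `LocalConditionsAbove`; the present definition is the
  intended value of that parameter on the compact side, relative to the same kind of datum `𝔅`
  that `GaloisRep.IsCrystalline` / `FramedRep.IsCrystallineWith` use.
* **The tensor is over `ℤ_p`** (`M ⊗[ℤ_[p]] B`), as in Bloch–Kato (`T` a free `ℤ_p`-module,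
  `B_crys ⊗_{ℚ_p} V`); for an `O`-lattice this is the same group as `T ⊗_O (O ⊗_{ℤ_p} B)`.
  The generic layer keeps the base ring `R` and the period ring `B` arbitrary; `M ⊗[R] B` has the
  module on the left so that Mathlib's `AlgebraTensorModule` supplies the `A`-linear structure.
* **Faithfulness check available in principle.**  Bloch–Kato's extension remark
  [BlochKato1990, p. 354] — for crystalline `V`, `x ∈ H¹_f(K, V)` iff the extension `E_x` of
  `ℚ_p` by `V` is crystalline — is a statement about `𝔅`-admissibility (`GaloisRep.IsCrystalline`)
  provable from Fontaine's regularity axioms recorded in `PeriodRingData`; it is not needed for the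
  definitions and is not proved here.
* **`ind_O`** is `ℕ∞`-valued (`⊤` = "infinitely divisible modulo torsion", e.g. for torsion `y`),
  uses `IsLocalRing.maximalIdeal A` and Mathlib's `Submodule.torsion A N` (elements killed by a
  non-zero-divisor; for a domain `O` the usual torsion).  No `O`-module structure beyond the one
  Mathlib puts on `continuousCohomology` is introduced: `H¹(K, T)`, `H¹(K_v, T)`, `H¹_s` are
  `A`-modules because `T` is.
* **Junk / scope.**  Nothing forces `v ∣ p`, `F/ℚ_p` finite, or `M` to be a lattice; the datum
  `𝔅` is abstract (as everywhere in the tree).  `H¹_e` (`B_crys^{φ=1}`) is not defined here.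

## References

* [BlochKato1990] S. Bloch, K. Kato, *L-functions and Tamagawa numbers of motives* (1990), §3:
  (3.7.2)–(3.7.3) (PDF pp. 21–22 = pp. 353–354), the extension remark and Prop. 3.8 (p. 354),
  Remark 1.18 (continuous cohomology, p. 341).
* [Rubin1998Durham] K. Rubin, *Euler systems and modular elliptic curves* (Durham 1996), §1
  (PDF p. 365: `H¹_𝒮(·, T)` = inverse image), §3 (PDF p. 367: `H¹_{/𝒮} = H¹/H¹_𝒮`,
  `loc_p^{ram}`).
* [Rubin2000] K. Rubin, *Euler Systems*, Ann. of Math. Studies 147 (2000), §1.3 (local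
  conditions `H¹_f`, `H¹_s`), §2.2 (Thm. 2.2.2: `ind_O(c)`).  Restatement read: A. Lei,
  D. Loeffler, S. L. Zerbes, Ann. of Math. 180 (2014), Thm. 7.1.5 and its gloss of `ind_O`.
-/

noncomputable section

open scoped TensorProduct NumberField
open CategoryTheory Field IsDedekindDomain TensorProduct

namespace Literature.NumberTheory.GaloisRepresentations

universe u v w

/-! ### Classes of `H¹_cont(G, M)` killed by a period ring `B` -/

section PeriodKernel

variable (R : Type*) [CommRing R]
variable {G : Type u} [Group G] [TopologicalSpace G]
variable {A : Type v} [CommRing A] [TopologicalSpace A] [Algebra R A]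
variable {M : Type u} [AddCommGroup M] [Module A M] [TopologicalSpace M] [Module R M]
  [IsScalarTower R A M]
variable (B : Type w) [CommRing B] [Algebra R B] [MulSemiringAction G B] [SMulCommClass G R B]

omit [TopologicalSpace G] in
/-- `G` fixes the inverse of the image in `B` of an element of `R` that becomes a unit there
(e.g. `1/p ∈ B_crys`). [folklore] -/
lemma smul_algebraMap_unit_inv (σ : G) {r : R} (hr : IsUnit (algebraMap R B r)) :
    σ • ((hr.unit⁻¹ : Bˣ) : B) = ((hr.unit⁻¹ : Bˣ) : B) := by
  have h1 : algebraMap R B r * ((hr.unit⁻¹ : Bˣ) : B) = 1 := hr.mul_val_inv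
  calc σ • ((hr.unit⁻¹ : Bˣ) : B)
      = σ • ((hr.unit⁻¹ : Bˣ) : B) * (algebraMap R B r * ((hr.unit⁻¹ : Bˣ) : B)) := by
        rw [h1, mul_one]
    _ = σ • (((hr.unit⁻¹ : Bˣ) : B) * algebraMap R B r) * ((hr.unit⁻¹ : Bˣ) : B) := by
        rw [smul_mul', smul_algebraMap, mul_assoc]
    _ = ((hr.unit⁻¹ : Bˣ) : B) := by
        rw [mul_comm _ (algebraMap R B r), h1, smul_one, one_mul]

namespace ContinuousRep

/-- The **diagonal representation** `σ ↦ τ(σ) ⊗ σ` of `G` on `M ⊗[R] B` attached to a continuous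
`A`-linear representation `τ` of `G` on `M` and a commutative `R`-algebra `B` on which `G` acts by
`R`-algebra automorphisms (Bloch–Kato's `T ⊗ B_crys`, Fontaine's `B ⊗ V`; compare
`PeriodRingData.tensorRep`, which has the factors in the other order).  It is `A`-linear through
the left factor (Mathlib `TensorProduct.AlgebraTensorModule.map`). [folklore] -/
def periodRep (τ : ContinuousRep G A M) : Representation A G (M ⊗[R] B) where
  toFun σ := AlgebraTensorModule.map (τ σ) (DistribMulAction.toModuleEnd R B σ)
  map_one' := by
    rw [map_one, map_one]
    exact AlgebraTensorModule.map_one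
  map_mul' σ σ' := by
    rw [map_mul, map_mul]
    exact AlgebraTensorModule.map_mul _ _ _ _

/-- Unfolding `periodRep` on pure tensors: `σ · (m ⊗ b) = τ(σ) m ⊗ σ b`. [folklore] -/
@[simp] lemma periodRep_apply_tmul (τ : ContinuousRep G A M) (σ : G) (m : M) (b : B) :
    τ.periodRep R B σ (m ⊗ₜ b) = τ σ m ⊗ₜ (σ • b) := rfl

variable [IsTopologicalAddGroup M] [ContinuousSMul A M]

/-- The continuous crossed homomorphisms `φ : G → M` **that become coboundaries in `M ⊗[R] B`**:
`∃ b ∈ M ⊗_R B, ∀ σ, φ(σ) ⊗ 1 = σ·b - b` (diagonal action `periodRep`).  An `A`-submodule of the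
tree's `contOneCocycles τ.toTopRep`. [folklore] -/
def periodCocycles (τ : ContinuousRep G A M) : Submodule A (contOneCocycles τ.toTopRep) where
  carrier := {φ | ∃ b : M ⊗[R] B, ∀ σ : G,
    (φ.1 σ : M) ⊗ₜ[R] (1 : B) = τ.periodRep R B σ b - b}
  zero_mem' := ⟨0, fun σ => by simp⟩
  add_mem' := by
    rintro φ ψ ⟨b, hb⟩ ⟨b', hb'⟩
    refine ⟨b + b', fun σ => ?_⟩
    change ((φ.1 σ : M) + ψ.1 σ) ⊗ₜ[R] (1 : B) = _
    rw [add_tmul, hb σ, hb' σ, map_add]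
    abel
  smul_mem' := by
    rintro a φ ⟨b, hb⟩
    refine ⟨a • b, fun σ => ?_⟩
    change (a • (φ.1 σ : M)) ⊗ₜ[R] (1 : B) = _
    rw [← smul_tmul', hb σ, map_smul, smul_sub]

/-- Membership in `periodCocycles`. [folklore] -/
lemma mem_periodCocycles_iff (τ : ContinuousRep G A M) (φ : contOneCocycles τ.toTopRep) :
    φ ∈ τ.periodCocycles R B ↔
      ∃ b : M ⊗[R] B, ∀ σ : G, (φ.1 σ : M) ⊗ₜ[R] (1 : B) = τ.periodRep R B σ b - b :=
  Iff.rfl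

variable [IsTopologicalGroup G]

/-- The **period kernel** `ker (H¹_cont(G, M) → H¹(G, M ⊗_R B))`: the classes in Mathlib's
`continuousCohomology 1 τ.toTopRep` of the continuous crossed homomorphisms that become
coboundaries in `M ⊗_R B` (`periodCocycles`, pushed forward along the tree's class map
`oneCocycleClassₗ`; the condition is independent of the representative,
`oneCocycleClass_mem_periodKernel_iff`).  Since in continuous-cochain cohomology the degree-`1`
coboundaries of `M ⊗ B` are exactly the maps `σ ↦ σ b - b`, this *is* the kernel of
`H¹(G, M) → H¹_cont(G, M ⊗ B)` for any topology on `B` making the action continuous — none is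
needed to state it.  With `B = B_crys` (resp. `B_dR`) and `G = Γ_K` this is Bloch–Kato's `H¹_f`
(resp. `H¹_g`). [cite: BlochKato1990, (3.7.2)–(3.7.3)] -/
def periodKernel (τ : ContinuousRep G A M) : Submodule A (continuousCohomology 1 τ.toTopRep) :=
  (τ.periodCocycles R B).map (oneCocycleClassₗ τ.toTopRep)

/-- **Well-definedness**: the class of a crossed homomorphism `φ` lies in the period kernel iff
`φ` itself becomes a coboundary in `M ⊗_R B` (two representatives differ by `σ ↦ σ v - v`, and
`(σ v - v) ⊗ 1 = σ·(v ⊗ 1) - v ⊗ 1` since `σ 1 = 1`). [folklore] -/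
theorem oneCocycleClass_mem_periodKernel_iff (τ : ContinuousRep G A M)
    (φ : contOneCocycles τ.toTopRep) :
    oneCocycleClass τ.toTopRep φ ∈ τ.periodKernel R B ↔
      ∃ b : M ⊗[R] B, ∀ σ : G, (φ.1 σ : M) ⊗ₜ[R] (1 : B) = τ.periodRep R B σ b - b := by
  constructor
  · rintro ⟨ψ, ⟨b, hb⟩, hψ⟩
    rw [oneCocycleClassₗ_apply] at hψ
    have h0 : oneCocycleClass τ.toTopRep (φ - ψ) = 0 := by
      rw [oneCocycleClass_sub, sub_eq_zero, hψ]
    obtain ⟨v, hv⟩ := (oneCocycleClass_eq_zero_iff _ _).1 h0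
    refine ⟨b + v ⊗ₜ[R] (1 : B), fun σ => ?_⟩
    have hv' : (φ.1 σ : M) = ψ.1 σ + (τ σ v - v) := by
      have h := hv σ
      change (φ.1 σ : M) - ψ.1 σ = τ σ v - v at h
      rw [← h, add_sub_cancel]
    rw [hv', add_tmul, hb σ, sub_tmul, map_add, periodRep_apply_tmul, smul_one]
    abel
  · rintro ⟨b, hb⟩
    exact ⟨φ, ⟨b, hb⟩, rfl⟩

/-- Membership in the period kernel, for an arbitrary class. [folklore] -/
theorem mem_periodKernel_iff (τ : ContinuousRep G A M) (x : continuousCohomology 1 τ.toTopRep) :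
    x ∈ τ.periodKernel R B ↔ ∃ φ : contOneCocycles τ.toTopRep, oneCocycleClass τ.toTopRep φ = x ∧
      ∃ b : M ⊗[R] B, ∀ σ : G, (φ.1 σ : M) ⊗ₜ[R] (1 : B) = τ.periodRep R B σ b - b := by
  constructor
  · rintro ⟨φ, hφ, rfl⟩
    exact ⟨φ, rfl, hφ⟩
  · rintro ⟨φ, rfl, hφ⟩
    exact ⟨φ, hφ, rfl⟩

/-- **Torsion dies in a period ring in which the exponent is invertible**: if `r ∈ R` becomes a
unit in `B` (e.g. `r = p^k`, `B` a `ℚ_p`-algebra) and `r · x = 0` in `H¹(G, M)`, then `x` lies in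
the period kernel (`r φ = δ t` gives `φ ⊗ 1 = δ (t ⊗ r⁻¹)`).  This is Bloch–Kato's remark "thus
`H¹_f(K, T)` always contains the torsion subgroup of `H¹(K, T)`".
[cite: BlochKato1990, after (3.7.3)] -/
theorem mem_periodKernel_of_smul_eq_zero (τ : ContinuousRep G A M) {r : R}
    (hr : IsUnit (algebraMap R B r)) {x : continuousCohomology 1 τ.toTopRep}
    (hx : algebraMap R A r • x = 0) : x ∈ τ.periodKernel R B := by
  obtain ⟨φ, rfl⟩ := oneCocycleClass_surjective _ x
  rw [← oneCocycleClass_smul, oneCocycleClass_eq_zero_iff] at hx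
  obtain ⟨t, ht⟩ := hx
  rw [oneCocycleClass_mem_periodKernel_iff]
  have h1 : algebraMap R B r * ((hr.unit⁻¹ : Bˣ) : B) = 1 := hr.mul_val_inv
  refine ⟨t ⊗ₜ[R] ((hr.unit⁻¹ : Bˣ) : B), fun σ => ?_⟩
  have hσ : algebraMap R A r • (φ.1 σ : M) = τ σ t - t := ht σ
  rw [periodRep_apply_tmul, smul_algebraMap_unit_inv R B σ hr, ← sub_tmul, ← hσ, algebraMap_smul,
    smul_tmul, Algebra.smul_def, h1]

/-- **Functoriality in the period ring**: a `G`-equivariant `R`-algebra map `B → B'` carries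
witnesses to witnesses, so the period kernel for `B` is contained in that for `B'` (e.g.
`B_crys → B_dR` gives `H¹_f ⊆ H¹_g`). [cite: BlochKato1990, (3.7.2)] -/
theorem periodKernel_mono {B' : Type*} [CommRing B'] [Algebra R B'] [MulSemiringAction G B']
    [SMulCommClass G R B'] (f : B →ₐ[R] B') (hf : ∀ (σ : G) (b : B), f (σ • b) = σ • f b)
    (τ : ContinuousRep G A M) : τ.periodKernel R B ≤ τ.periodKernel R B' := by
  intro x hx
  obtain ⟨φ, rfl⟩ := oneCocycleClass_surjective _ x
  rw [oneCocycleClass_mem_periodKernel_iff] at hx ⊢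
  obtain ⟨b, hb⟩ := hx
  let F : M ⊗[R] B →ₗ[A] M ⊗[R] B' := AlgebraTensorModule.map LinearMap.id f.toLinearMap
  have hF : ∀ σ (y : M ⊗[R] B), F (τ.periodRep R B σ y) = τ.periodRep R B' σ (F y) := by
    intro σ y
    induction y using TensorProduct.induction_on with
    | zero => simp only [map_zero]
    | tmul m c =>
        simp only [F, periodRep_apply_tmul, AlgebraTensorModule.map_tmul, LinearMap.id_apply,
          AlgHom.toLinearMap_apply, hf]
    | add y z hy hz => simp only [map_add, hy, hz]
  refine ⟨F b, fun σ => ?_⟩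
  have h := congrArg F (hb σ)
  simp only [F, AlgebraTensorModule.map_tmul, LinearMap.id_apply, AlgHom.toLinearMap_apply,
    map_one, map_sub] at h
  rw [h, ← hF]

/-- **No Galois action on `B`, no kernel.**  If `G` acts trivially on `B` and `B` retracts
`R`-linearly onto `R` (`ε 1 = 1`; e.g. `B = R`, or `B` free over `R` with `1` in a basis), then the
period kernel is zero: applying `m ⊗ c ↦ ε(c) m` to `φ(σ) ⊗ 1 = σ·b - b` exhibits `φ` as the
principal crossed homomorphism of `π(b)`.  (So all the content of `H¹_f` sits in the action of
`Γ_K` on `B_crys`.) [folklore] -/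
theorem periodKernel_eq_bot_of_smul_eq (htriv : ∀ (σ : G) (b : B), σ • b = b)
    (ε : B →ₗ[R] R) (hε : ε 1 = 1) (τ : ContinuousRep G A M) : τ.periodKernel R B = ⊥ := by
  refine (Submodule.eq_bot_iff _).2 fun x hx => ?_
  obtain ⟨φ, rfl⟩ := oneCocycleClass_surjective _ x
  rw [oneCocycleClass_mem_periodKernel_iff] at hx
  obtain ⟨b, hb⟩ := hx
  let π : M ⊗[R] B →ₗ[R] M := (TensorProduct.rid R M).toLinearMap ∘ₗ LinearMap.lTensor M ε
  have hπ_tmul : ∀ (m : M) (c : B), π (m ⊗ₜ c) = ε c • m := fun m c => by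
    simp only [π, LinearMap.comp_apply, LinearMap.lTensor_tmul, LinearEquiv.coe_coe,
      TensorProduct.rid_tmul]
  have hπ : ∀ σ (y : M ⊗[R] B),
      π ((τ.periodRep R B σ).restrictScalars R y) = τ σ (π y) := by
    intro σ y
    induction y using TensorProduct.induction_on with
    | zero => simp only [map_zero]
    | tmul m c =>
        rw [LinearMap.restrictScalars_apply, periodRep_apply_tmul, htriv, hπ_tmul, hπ_tmul,
          LinearMap.map_smul_of_tower]
    | add y z hy hz => simp only [map_add, hy, hz]
  rw [oneCocycleClass_eq_zero_iff]
  refine ⟨π b, fun σ => ?_⟩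
  have h := congrArg π (hb σ)
  rw [hπ_tmul, hε, one_smul, map_sub] at h
  change (φ.1 σ : M) = τ σ (π b) - π b
  rw [h, ← hπ σ b, LinearMap.restrictScalars_apply]


/-! #### Naturality in the module: the preimage description -/

section Naturality

variable {M' : Type u} [AddCommGroup M'] [Module A M'] [TopologicalSpace M'] [Module R M']
  [IsScalarTower R A M'] [IsTopologicalAddGroup M'] [ContinuousSMul A M']

omit [MulSemiringAction G B] [SMulCommClass G R B] [IsTopologicalGroup G] in
/-- The base change `f ⊗ B : M ⊗_R B → M' ⊗_R B` of a morphism of representations. [folklore] -/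
def periodBaseChange (τ : ContinuousRep G A M) (τ' : ContinuousRep G A M')
    (f : τ.toTopRep ⟶ τ'.toTopRep) : M ⊗[R] B →ₗ[A] M' ⊗[R] B :=
  AlgebraTensorModule.map f.hom.toContinuousLinearMap.toLinearMap LinearMap.id

omit [MulSemiringAction G B] [SMulCommClass G R B] [IsTopologicalGroup G] in
/-- Unfolding `periodBaseChange` on pure tensors. [folklore] -/
@[simp] theorem periodBaseChange_tmul (τ : ContinuousRep G A M) (τ' : ContinuousRep G A M')
    (f : τ.toTopRep ⟶ τ'.toTopRep) (m : M) (c : B) :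
    periodBaseChange R B τ τ' f (m ⊗ₜ c) = f.hom m ⊗ₜ c := rfl

omit [IsTopologicalGroup G] in
/-- `f ⊗ B` intertwines the diagonal actions (`f` is `G`-equivariant). [folklore] -/
theorem periodBaseChange_periodRep (τ : ContinuousRep G A M) (τ' : ContinuousRep G A M')
    (f : τ.toTopRep ⟶ τ'.toTopRep) (σ : G) (y : M ⊗[R] B) :
    periodBaseChange R B τ τ' f (τ.periodRep R B σ y) =
      τ'.periodRep R B σ (periodBaseChange R B τ τ' f y) := by
  induction y using TensorProduct.induction_on with
  | zero => simp only [map_zero]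
  | tmul m c =>
      rw [periodRep_apply_tmul, periodBaseChange_tmul, periodBaseChange_tmul, periodRep_apply_tmul]
      congr 1
      exact TopRep.hom_comm_apply f σ m
  | add y z hy hz => simp only [map_add, hy, hz]

/-- **Naturality of the period kernel in the module**: for a morphism of representations
`f : M → M'` (continuous, `A`-linear, `G`-equivariant), `H¹(f)` (the tree's `cohomologyMap f 1`)
maps the period kernel of `M` into that of `M'` (the witness `b` goes to `(f ⊗ B) b`). [folklore] -/
theorem map_periodKernel_le (τ : ContinuousRep G A M) (τ' : ContinuousRep G A M')
    (f : τ.toTopRep ⟶ τ'.toTopRep) :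
    (τ.periodKernel R B).map (cohomologyMap f 1).hom.toLinearMap ≤ τ'.periodKernel R B := by
  rintro _ ⟨x, hx, rfl⟩
  obtain ⟨φ, rfl⟩ := oneCocycleClass_surjective _ x
  rw [SetLike.mem_coe, oneCocycleClass_mem_periodKernel_iff] at hx
  obtain ⟨b, hb⟩ := hx
  change cohomologyMap f 1 (oneCocycleClass _ φ) ∈ τ'.periodKernel R B
  rw [cohomologyMap_oneCocycleClass, oneCocycleClass_mem_periodKernel_iff]
  refine ⟨periodBaseChange R B τ τ' f b, fun σ => ?_⟩
  have h := congrArg (periodBaseChange R B τ τ' f) (hb σ)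
  rw [periodBaseChange_tmul, map_sub, periodBaseChange_periodRep] at h
  rw [pullback_id_resIdHom_apply]
  exact h

/-- **The preimage description** (Bloch–Kato's (3.7.3), abstractly): if `f ⊗ B : M ⊗_R B →
M' ⊗_R B` is bijective — e.g. `f : T ↪ V = T ⊗ ℚ_p` and `B` a `ℚ_p`-algebra, where
`T ⊗_{ℤ_p} B = V ⊗_{ℤ_p} B` — then the period kernel of `M` is the **preimage under `H¹(f)`** of
the period kernel of `M'`: `H¹_f(K, T) = ι⁻¹ H¹_f(K, V)`. [cite: BlochKato1990, (3.7.3)] -/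
theorem periodKernel_eq_comap (τ : ContinuousRep G A M) (τ' : ContinuousRep G A M')
    (f : τ.toTopRep ⟶ τ'.toTopRep) (hf : Function.Bijective (periodBaseChange R B τ τ' f)) :
    τ.periodKernel R B = (τ'.periodKernel R B).comap (cohomologyMap f 1).hom.toLinearMap := by
  refine le_antisymm (fun x hx => ?_) (fun x hx => ?_)
  · exact (Submodule.mem_comap).2 (map_periodKernel_le R B τ τ' f ⟨x, hx, rfl⟩)
  · rw [Submodule.mem_comap] at hx
    obtain ⟨φ, rfl⟩ := oneCocycleClass_surjective _ x
    change cohomologyMap f 1 (oneCocycleClass _ φ) ∈ τ'.periodKernel R B at hx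
    rw [cohomologyMap_oneCocycleClass, oneCocycleClass_mem_periodKernel_iff] at hx
    obtain ⟨b', hb'⟩ := hx
    let e : M ⊗[R] B ≃ₗ[A] M' ⊗[R] B := LinearEquiv.ofBijective _ hf
    rw [oneCocycleClass_mem_periodKernel_iff]
    refine ⟨e.symm b', fun σ => e.injective ?_⟩
    have hσ := hb' σ
    rw [pullback_id_resIdHom_apply] at hσ
    change periodBaseChange R B τ τ' f _ = periodBaseChange R B τ τ' f _
    rw [periodBaseChange_tmul, map_sub, periodBaseChange_periodRep]
    change _ = τ'.periodRep R B σ (e (e.symm b')) - e (e.symm b')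
    rw [LinearEquiv.apply_symm_apply]
    exact hσ

end Naturality

end ContinuousRep

end PeriodKernel

/-! ### The Bloch–Kato finite part `H¹_f(F, T)` relative to a crystalline period-ring datum -/

section BlochKato

variable (p : ℕ) [Fact p.Prime]
variable {F : Type u} [Field F] [Algebra ℚ_[p] F]

namespace CrystallinePeriodRingData

variable (𝔅 : CrystallinePeriodRingData.{0, u, w} ℚ_[p] F)

/-- The period ring of a crystalline datum over `ℚ_p` is a `ℤ_p`-algebra through
`ℤ_p → ℚ_p → B` (so that `ℤ_p`-lattices can be tensored with it). [folklore] -/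
instance instAlgebraPadicInt : Algebra ℤ_[p] 𝔅.toPeriodRingData.B :=
  ((algebraMap ℚ_[p] 𝔅.toPeriodRingData.B).comp (algebraMap ℤ_[p] ℚ_[p])).toAlgebra

/-- Unfolding the `ℤ_p`-algebra structure: `ℤ_p → B` factors through `ℚ_p`. [folklore] -/
lemma algebraMap_padicInt (r : ℤ_[p]) :
    algebraMap ℤ_[p] 𝔅.toPeriodRingData.B r = algebraMap ℚ_[p] 𝔅.toPeriodRingData.B (r : ℚ_[p]) :=
  rfl

/-- `ℤ_p → ℚ_p → B` is a scalar tower. [folklore] -/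
instance instIsScalarTowerPadicInt : IsScalarTower ℤ_[p] ℚ_[p] 𝔅.toPeriodRingData.B :=
  IsScalarTower.of_algebraMap_eq fun _ => rfl

/-- The Galois action on the period ring is `ℤ_p`-linear (it is `ℚ_p`-linear). [folklore] -/
instance instSMulCommClassPadicInt :
    SMulCommClass (absoluteGaloisGroup F) ℤ_[p] 𝔅.toPeriodRingData.B where
  smul_comm σ r b := by
    rw [Algebra.smul_def, Algebra.smul_def, smul_mul', algebraMap_padicInt, smul_algebraMap]

/-- A nonzero `p`-adic integer becomes a unit in the period ring (a `ℚ_p`-algebra). [folklore] -/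
lemma isUnit_algebraMap_padicInt {r : ℤ_[p]} (hr : r ≠ 0) :
    IsUnit (algebraMap ℤ_[p] 𝔅.toPeriodRingData.B r) := by
  rw [algebraMap_padicInt]
  exact (IsUnit.mk0 _ ((PadicInt.coe_ne_zero).2 hr)).map _

end CrystallinePeriodRingData

variable {A : Type v} [CommRing A] [TopologicalSpace A] [Algebra ℤ_[p] A]
variable {M : Type u} [AddCommGroup M] [Module A M] [TopologicalSpace M] [IsTopologicalAddGroup M]
  [ContinuousSMul A M] [Module ℤ_[p] M] [IsScalarTower ℤ_[p] A M]

namespace GaloisRep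

/-- **Bloch–Kato's finite part `H¹_f(F, T) ⊆ H¹(F, T)`** of a continuous representation `τ` of
`Γ_F` (`F ⊇ ℚ_p` a field, intended a finite extension of `ℚ_p`) on an `A`-module `M` which is
also a `ℤ_p`-module compatibly (intended: `A = O` the integers of a finite extension of `ℚ_p` and
`M = T` an `O`-lattice; also `A` a `ℚ_p`-algebra and `M = V`), **relative to a crystalline
period-ring datum `𝔅`** (intended `B_crys(F)`): the classes `[c] ∈ H¹_cont(Γ_F, T)` such that
`∃ b ∈ T ⊗_{ℤ_p} B, ∀ σ, c(σ) ⊗ 1 = σ·b - b` — i.e. `ker (H¹(F, T) → H¹(F, T ⊗_{ℤ_p} B_crys))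
= ι⁻¹ ker (H¹(F, V) → H¹(F, B_crys ⊗_{ℚ_p} V))`, Bloch–Kato's (3.7.2)–(3.7.3) (module docstring
for why no topology on `B` enters).  An `A`-submodule of `continuousCohomology 1 τ.toTopRep`.
[cite: BlochKato1990, (3.7.2)–(3.7.3)] -/
def blochKatoFiniteSubmodule (𝔅 : CrystallinePeriodRingData.{0, u, w} ℚ_[p] F)
    (τ : GaloisRep F A M) : Submodule A (continuousCohomology 1 τ.toTopRep) :=
  ContinuousRep.periodKernel ℤ_[p] 𝔅.toPeriodRingData.B τ

/-- Unfolding `blochKatoFiniteSubmodule`. [folklore] -/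
theorem blochKatoFiniteSubmodule_eq (𝔅 : CrystallinePeriodRingData.{0, u, w} ℚ_[p] F)
    (τ : GaloisRep F A M) :
    τ.blochKatoFiniteSubmodule p 𝔅 = ContinuousRep.periodKernel ℤ_[p] 𝔅.toPeriodRingData.B τ :=
  rfl

/-- Membership of the class of a continuous crossed homomorphism `c : Γ_F → T` in `H¹_f(F, T)`:
`∃ b ∈ T ⊗_{ℤ_p} B_crys, ∀ σ, c(σ) ⊗ 1 = σ·b - b`. [cite: BlochKato1990, (3.7.2)–(3.7.3)] -/
theorem oneCocycleClass_mem_blochKatoFiniteSubmodule_iff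
    (𝔅 : CrystallinePeriodRingData.{0, u, w} ℚ_[p] F) (τ : GaloisRep F A M)
    (φ : contOneCocycles τ.toTopRep) :
    oneCocycleClass τ.toTopRep φ ∈ τ.blochKatoFiniteSubmodule p 𝔅 ↔
      ∃ b : M ⊗[ℤ_[p]] 𝔅.toPeriodRingData.B, ∀ σ : absoluteGaloisGroup F,
        (φ.1 σ : M) ⊗ₜ[ℤ_[p]] (1 : 𝔅.toPeriodRingData.B) =
          ContinuousRep.periodRep ℤ_[p] 𝔅.toPeriodRingData.B τ σ b - b :=
  ContinuousRep.oneCocycleClass_mem_periodKernel_iff _ _ τ φ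

/-- **`H¹_f(F, T)` contains the `ℤ_p`-torsion of `H¹(F, T)`**: if `r · x = 0` for a nonzero
`r ∈ ℤ_p` then `x ∈ H¹_f(F, T)`. [cite: BlochKato1990, after (3.7.3)] -/
theorem mem_blochKatoFiniteSubmodule_of_smul_eq_zero
    (𝔅 : CrystallinePeriodRingData.{0, u, w} ℚ_[p] F) (τ : GaloisRep F A M) {r : ℤ_[p]}
    (hr : r ≠ 0) {x : continuousCohomology 1 τ.toTopRep} (hx : algebraMap ℤ_[p] A r • x = 0) :
    x ∈ τ.blochKatoFiniteSubmodule p 𝔅 :=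
  ContinuousRep.mem_periodKernel_of_smul_eq_zero _ _ τ (𝔅.isUnit_algebraMap_padicInt p hr) hx

/-- In particular the `p`-power torsion of `H¹(F, T)` lies in `H¹_f(F, T)`.
[cite: BlochKato1990, after (3.7.3)] -/
theorem mem_blochKatoFiniteSubmodule_of_pow_smul_eq_zero
    (𝔅 : CrystallinePeriodRingData.{0, u, w} ℚ_[p] F) (τ : GaloisRep F A M) (k : ℕ)
    {x : continuousCohomology 1 τ.toTopRep} (hx : ((p : A) ^ k) • x = 0) :
    x ∈ τ.blochKatoFiniteSubmodule p 𝔅 := by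
  refine τ.mem_blochKatoFiniteSubmodule_of_smul_eq_zero p 𝔅
    (pow_ne_zero k (by exact_mod_cast (Fact.out : p.Prime).ne_zero) : (p : ℤ_[p]) ^ k ≠ 0) ?_
  rwa [map_pow, map_natCast]

end GaloisRep

end BlochKato

/-! ### Over a number field: `H¹_f(K_v, T)`, `H¹_s(K_v, T)` and `loc_v^s` -/

section NumberField

variable {K : Type u} [Field K] [NumberField K] (p : ℕ) [Fact p.Prime]
variable {A : Type v} [CommRing A] [TopologicalSpace A] [Algebra ℤ_[p] A]
variable {M : Type u} [AddCommGroup M] [Module A M] [TopologicalSpace M] [IsTopologicalAddGroup M]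
  [ContinuousSMul A M] [Module ℤ_[p] M] [IsScalarTower ℤ_[p] A M]

/-- **Crystalline period data at a finite place `v`** of the number field `K` (intended `v ∣ p`):
a `ℚ_p`-algebra structure on `K_v = v.adicCompletion K` (Mathlib has no such instance; the tree
constructs it as `LocalField.adicCompletionPadicAlgebra v p hv`) together with a crystalline
period-ring datum for `K_v` over `ℚ_p` (intended: `B_crys(K_v)` with `F₀ = K_{v,0}` and `φ`) —
the dependent-pair shape used by `GaloisRep.IsGeometric`. [folklore] -/
abbrev CrystallineDatumAt (v : HeightOneSpectrum (𝓞 K)) : Type (max u (w + 1)) :=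
  Σ' (_ : Algebra ℚ_[p] (v.adicCompletion K)),
    CrystallinePeriodRingData.{0, u, w} ℚ_[p] (v.adicCompletion K)

namespace GaloisRep

variable (T : GaloisRep K A M) (v : HeightOneSpectrum (𝓞 K)) (𝔅 : CrystallineDatumAt.{u, w} p v)

/-- **`H¹_f(K_v, T) ⊆ H¹(K_v, T)`, the Bloch–Kato finite part on the compact side at a place
`v ∣ p`** (the notion `blochKatoFiniteSubgroupCompact`): for a continuous representation `T` of
`Γ_K` on an `A`-module which is a `ℤ_p`-module compatibly (intended: a `Γ_K`-stable `O`-lattice,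
e.g. `FramedGaloisRep.toGaloisRep` of `Γ_K → GL_n(O)`), the finite part
`blochKatoFiniteSubmodule` of the local representation `T.toLocal v` on
`H¹(K_v, T) = continuousCohomology 1 (T.toLocal v).toTopRep` (the target of the localisation
`GaloisRep.localizeH T v 1`), relative to crystalline period data `𝔅` at `v`:
`H¹_f(K_v, T) = ι⁻¹ ker (H¹(K_v, V) → H¹(K_v, B_crys ⊗ V))`.  An `A`-submodule (in particular a
subgroup). [cite: BlochKato1990, (3.7.2)–(3.7.3)] -/
def blochKatoFiniteSubgroupCompact :
    Submodule A (continuousCohomology 1 (T.toLocal v).toTopRep) :=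
  letI := 𝔅.1
  (T.toLocal v).blochKatoFiniteSubmodule p 𝔅.2

/-- Unfolding `blochKatoFiniteSubgroupCompact`. [folklore] -/
theorem blochKatoFiniteSubgroupCompact_eq :
    T.blochKatoFiniteSubgroupCompact p v 𝔅 =
      (letI := 𝔅.1; (T.toLocal v).blochKatoFiniteSubmodule p 𝔅.2) :=
  rfl

/-- Membership of the class of a continuous crossed homomorphism `c : Γ_{K_v} → T` in
`H¹_f(K_v, T)`: `∃ b ∈ T ⊗_{ℤ_p} B_crys(K_v), ∀ σ, c(σ) ⊗ 1 = σ·b - b`.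
[cite: BlochKato1990, (3.7.2)–(3.7.3)] -/
theorem oneCocycleClass_mem_blochKatoFiniteSubgroupCompact_iff
    (φ : contOneCocycles (T.toLocal v).toTopRep) :
    oneCocycleClass (T.toLocal v).toTopRep φ ∈ T.blochKatoFiniteSubgroupCompact p v 𝔅 ↔
      (letI := 𝔅.1
       ∃ b : M ⊗[ℤ_[p]] 𝔅.2.toPeriodRingData.B, ∀ σ : absoluteGaloisGroup (v.adicCompletion K),
        (φ.1 σ : M) ⊗ₜ[ℤ_[p]] (1 : 𝔅.2.toPeriodRingData.B) =
          ContinuousRep.periodRep ℤ_[p] 𝔅.2.toPeriodRingData.B (T.toLocal v) σ b - b) := by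
  letI := 𝔅.1
  exact (T.toLocal v).oneCocycleClass_mem_blochKatoFiniteSubmodule_iff p 𝔅.2 φ

/-- **The singular quotient `H¹_s(K_v, T) = H¹(K_v, T) ⧸ H¹_f(K_v, T)`** (Rubin 2000: `H¹_s`;
Rubin 1998: `H¹_{/𝒮}`), an `A`-module. [cite: Rubin1998Durham, §3] -/
abbrev blochKatoSingularQuotient : Type u :=
  (continuousCohomology 1 (T.toLocal v).toTopRep) ⧸ T.blochKatoFiniteSubgroupCompact p v 𝔅

/-- **`loc_v^s : H¹(K, T) → H¹_s(K_v, T)`**, the localisation at `v` (`GaloisRep.localizeH`,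
restriction to the decomposition group `Γ_{K_v} → Γ_K`) followed by the quotient map by
`H¹_f(K_v, T)` (Rubin 1998: `loc_p^{ram} : H¹(ℚ_n, T) → H¹_{/𝒮}(ℚ_{n,p}, T)`; Rubin 2000:
`loc^s`).  `A`-linear. [cite: Rubin1998Durham, §3] -/
def locSingular : continuousCohomology 1 T.toTopRep →ₗ[A] T.blochKatoSingularQuotient p v 𝔅 :=
  (T.blochKatoFiniteSubgroupCompact p v 𝔅).mkQ ∘ₗ (T.localizeH v 1).hom.toLinearMap

/-- Unfolding `locSingular`: the class of `loc_v c` modulo `H¹_f(K_v, T)`. [folklore] -/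
theorem locSingular_apply (c : continuousCohomology 1 T.toTopRep) :
    T.locSingular p v 𝔅 c = Submodule.Quotient.mk (T.localizeH v 1 c) :=
  rfl

/-- **`loc_v^s c = 0 ↔ loc_v c ∈ H¹_f(K_v, T)`** ("`c` is crystalline at `v`"). [folklore] -/
theorem locSingular_eq_zero_iff (c : continuousCohomology 1 T.toTopRep) :
    T.locSingular p v 𝔅 c = 0 ↔ T.localizeH v 1 c ∈ T.blochKatoFiniteSubgroupCompact p v 𝔅 := by
  rw [locSingular_apply, Submodule.Quotient.mk_eq_zero]

/-- The kernel of `loc_v^s` is the preimage of `H¹_f(K_v, T)` under `loc_v` (the local condition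
at `v` of the compact Selmer group). [folklore] -/
theorem ker_locSingular :
    LinearMap.ker (T.locSingular p v 𝔅) =
      (T.blochKatoFiniteSubgroupCompact p v 𝔅).comap (T.localizeH v 1).hom.toLinearMap := by
  ext c
  rw [LinearMap.mem_ker, locSingular_eq_zero_iff, Submodule.mem_comap]
  rfl

/-- `p`-power-torsion classes of `H¹(K_v, T)` die in `H¹_s(K_v, T)` (they lie in `H¹_f(K_v, T)`).
[cite: BlochKato1990, after (3.7.3)] -/
theorem mkQ_eq_zero_of_pow_smul_eq_zero (k : ℕ) {y : continuousCohomology 1 (T.toLocal v).toTopRep}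
    (hy : ((p : A) ^ k) • y = 0) :
    (T.blochKatoFiniteSubgroupCompact p v 𝔅).mkQ y = 0 := by
  rw [Submodule.mkQ_apply, Submodule.Quotient.mk_eq_zero]
  letI := 𝔅.1
  exact (T.toLocal v).mem_blochKatoFiniteSubmodule_of_pow_smul_eq_zero p 𝔅.2 k hy

end GaloisRep

end NumberField

/-! ### Rubin's index of divisibility -/

section IndexOfDivisibility

variable (A : Type*) [CommRing A] [IsLocalRing A] {N : Type*} [AddCommGroup N] [Module A N]

/-- **Rubin's index of divisibility** of an element `y` of a module `N` over a local ring `A`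
(intended: `A = O` a discrete valuation ring, `N = H¹(K, T)` or `H¹_s(K_v, T)`):
`ind_A(y) = sup {m : y ∈ 𝔪_A^m N + N_tors} ∈ ℕ ∪ {∞}`, "the largest power of the maximal ideal by
which `y` can be divided in `N / N_tors`" (`⊤` when `y` is divisible by every power modulo
torsion, e.g. `y` torsion).  `𝔪_A = IsLocalRing.maximalIdeal A`, `N_tors = Submodule.torsion A N`.
[cite: Rubin2000, §2.2 (Thm. 2.2.2)] -/
def indexOfDivisibility (y : N) : ℕ∞ :=
  ⨆ (m : ℕ) (_ : y ∈ IsLocalRing.maximalIdeal A ^ m • (⊤ : Submodule A N) ⊔ Submodule.torsion A N),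
    (m : ℕ∞)

/-- A witnessed divisibility bounds the index from below: `y ∈ 𝔪^m N + N_tors ⇒ m ≤ ind_A(y)`.
[folklore] -/
theorem le_indexOfDivisibility {y : N} {m : ℕ}
    (h : y ∈ IsLocalRing.maximalIdeal A ^ m • (⊤ : Submodule A N) ⊔ Submodule.torsion A N) :
    (m : ℕ∞) ≤ indexOfDivisibility A y :=
  le_iSup₂ (f := fun (m : ℕ)
    (_ : y ∈ IsLocalRing.maximalIdeal A ^ m • (⊤ : Submodule A N) ⊔ Submodule.torsion A N) =>
      (m : ℕ∞)) m h

/-- `ind_A(y) ≤ n` iff every witnessed divisibility exponent is `≤ n`. [folklore] -/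
theorem indexOfDivisibility_le_iff {y : N} {n : ℕ∞} :
    indexOfDivisibility A y ≤ n ↔
      ∀ m : ℕ, y ∈ IsLocalRing.maximalIdeal A ^ m • (⊤ : Submodule A N) ⊔ Submodule.torsion A N →
        (m : ℕ∞) ≤ n :=
  iSup₂_le_iff

/-- A torsion element is divisible by every power of `𝔪` modulo torsion: `ind_A(y) = ∞`.
[folklore] -/
theorem indexOfDivisibility_eq_top_of_mem_torsion {y : N} (h : y ∈ Submodule.torsion A N) :
    indexOfDivisibility A y = ⊤ := by
  have e : ∀ m : ℕ, (⨆ (_ : y ∈ IsLocalRing.maximalIdeal A ^ m • (⊤ : Submodule A N) ⊔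
      Submodule.torsion A N), (m : ℕ∞)) = m :=
    fun m => iSup_pos (Submodule.mem_sup_right h)
  rw [indexOfDivisibility, iSup_congr e, ENat.iSup_coe_eq_top]
  rintro ⟨n, hn⟩
  exact Nat.lt_irrefl n (Nat.lt_of_lt_of_le n.lt_succ_self (hn ⟨n + 1, rfl⟩))

/-- `ind_A(0) = ∞`. [folklore] -/
theorem indexOfDivisibility_zero : indexOfDivisibility A (0 : N) = ⊤ :=
  indexOfDivisibility_eq_top_of_mem_torsion A (zero_mem _)

end IndexOfDivisibility

end Literature.NumberTheory.GaloisRepresentations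

end
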